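import Literature.NumberTheory.EllipticCurves.TwoAdicImageSurjectivityModTwoProofs
import HarnessLib

/-!
# A KERNEL CERTIFICATE for `E[2] ≅ A[2]` as Galois modules: the Tschirnhaus road on the `2`-division cubics
# (route `ThetaPartnerAtTwo`, the habitat clause of K1 `SignedTransportAtTwo` 20333 / slice leaf
# `WAllNonCMAtTwoThetaHabitat`; route `ByReductionTypeAtTwo`, crux 19097 on the theta habitat — seat `bsd-2adic-ss-1x`)

HONEST FRAMING (cells `bsd-2adic`, `bsd-wall`; HUMAN RULINGS D-0036/D-0054/D-0074): THEOREMS ONLY — no definition, no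
named fact, no instance, no `sorry`. Pure algebra over an arbitrary field `K` with `2 ≠ 0`; nothing about BSD. It turns
the «`E[2] ≅ A[2]` certified exactly» column of HABITAT-CENSUS-TP2-v1.md (bsd-wall-p2, resultant factorisations) into a
KERNEL-CHECKABLE per-class statement: two polynomial congruences modulo the `2`-division cubic of `E`.

## Statement

Let `W, A` be elliptic curves over a field `K` with `2 ≠ 0`, `ψ_W = 4x³ + b₂x² + 2b₄x + b₆` (Mathlib's
`twoTorsionPolynomial`; its roots in `K̄` are the abscissae of `E[2] ∖ O`) and likewise `ψ_A`. Suppose `q, r ∈ K[x]`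
satisfy, for every root `ξ ∈ K̄` of `ψ_W`: `ψ_A(q(ξ)) = 0` and `r(q(ξ)) = ξ` (a TSCHIRNHAUS TRANSFORMATION `q` carrying
the roots of `ψ_W` to roots of `ψ_A`, with a polynomial left inverse `r` on those roots — e.g. `ψ_W ∣ ψ_A ∘ q` and
`ψ_W ∣ r ∘ q − x` in `K[x]`). THEN there is an additive isomorphism `e : W[2] ≃ A[2]` of the geometric `2`-torsion
commuting with the absolute Galois group `Γ_K`: `e(σP) = σ e(P)`
(`exists_equivariant_addEquiv_geomTorsion_two_of_tschirnhaus`).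

Proof (Silverman AEC III.§1–§2, III.6.4(b), VIII.§1; the tree's `DokchitserDokchitser2012` bookkeeping
`T, xT, permGal, frame, roots_twoTorsionPolynomial`): `ξ_i = x(T_i^W)` are the three roots of `ψ_W`, `q(ξ_i)` is a root
of `ψ_A`, hence `= x(T^A_{π i})`; `π` is injective by the left inverse `r`, so a permutation; since `q, r` have
coefficients in `K`, `σ(q(ξ)) = q(σ ξ)` gives `π ∘ permGal_W(σ) = permGal_A(σ) ∘ π`; and ANY permutation of the three
nonzero vectors of `(ℤ/2)²` is additive (`exists_addEquiv_apply_vec_eq`, kernel `decide` over `S₃`), so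
`T_i^W ↦ T^A_{π i}` extends to the required `e` through the frames `E[2] ≅ (ℤ/2)²`.

Why this is the right certificate (HABITAT-CENSUS-TP2-v1 §1): if `ℚ(E[2]) = ℚ(A[2]) = M` with `Gal(M/ℚ) ≅ S₃`, the
cubic fields `ℚ(ξ)` and `ℚ(x(T^A))` are conjugate subfields of `M`, so some root of `ψ_A` lies in `ℚ(ξ)`, i.e. is
`q(ξ)` with `deg q ≤ 2`, and `r` exists because `q(ξ)` generates the same cubic field; conversely the theorem. The pair
`(q, r)` is found by `nfisisom` / linear algebra per class and CHECKED here by `linear_combination` over `ℚ̄`.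

References: [SilvermanAEC2009] III.§1 (the `2`-division cubic), III.2.3, Cor. III.6.4(b), III.§7, VIII.§1;
[DokchitserDokchitserMathZ2012] proof of the Theorem, first paragraph; HABITAT-CENSUS-TP2-v1.md (bsd-wall-p2 g2, 7fe48c52e6a49e6b).
-/

set_option autoImplicit false
-- the Theorems namespace of this sub repeats the summit name by design (D-0017 nested layout)
set_option linter.dupNamespace false

noncomputable section

open scoped Classical Polynomial

open WeierstrassCurve Literature.NumberTheory.EllipticCurves
  Literature.NumberTheory.EllipticCurves.DokchitserDokchitser2012

namespace Summit.BirchSwinnertonDyer.BirchSwinnertonDyer.Theorems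

namespace ThetaPartnerXRoute

universe u

/-! ## §1 `(ℤ/2)²`: every permutation of the three nonzero vectors is additive -/

/-- Every permutation of three letters is one of the six words in the transpositions `(0 1)`, `(0 2)`.
[folklore: `S₃` by enumeration] -/
theorem perm_three_cases' :
    ∀ g : Equiv.Perm (Fin 3), g = 1 ∨ g = Equiv.swap 0 1 ∨ g = Equiv.swap 0 2 ∨
      g = Equiv.swap 0 1 * Equiv.swap 0 2 * Equiv.swap 0 1 ∨
      g = Equiv.swap 0 1 * Equiv.swap 0 2 ∨ g = Equiv.swap 0 2 * Equiv.swap 0 1 := by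
  decide

/-- **Every permutation `π` of the three nonzero vectors `v₀ = (1,0)`, `v₁ = (0,1)`, `v₂ = (1,1)` of `(ℤ/2)²` is
induced by an additive automorphism** (`GL₂(𝔽₂) = S₃`): explicit words in the coordinate swap and the shear
`(a,b) ↦ (a, a+b)`. [folklore: `GL₂(𝔽₂) ≅ S₃`] -/
theorem exists_addEquiv_apply_vec_eq (π : Equiv.Perm (Fin 3)) :
    ∃ L : ZMod 2 × ZMod 2 ≃+ ZMod 2 × ZMod 2, ∀ i : Fin 3, L (vec i) = vec (π i) := by
  rcases perm_three_cases' π with rfl | rfl | rfl | rfl | rfl | rfl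
  · exact ⟨AddEquiv.refl _, fun i ↦ rfl⟩
  · exact ⟨AddEquiv.prodComm, by decide⟩
  · exact ⟨shear, by decide⟩
  · exact ⟨AddEquiv.prodComm.trans (shear.trans AddEquiv.prodComm), by decide⟩
  · exact ⟨shear.trans AddEquiv.prodComm, by decide⟩
  · exact ⟨AddEquiv.prodComm.trans shear, by decide⟩

/-! ## §2 The certificate theorem -/

section Certificate

variable {K : Type u} [Field K] (h2 : (2 : K) ≠ 0) (W A : WeierstrassCurve K) [W.IsElliptic] [A.IsElliptic]

/-- The abscissa `x_i = x(T_i)` of a nonzero `2`-torsion point is a root of the `2`-division cubic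
`ψ = 4x³ + b₂x² + 2b₄x + b₆` (with coefficients in `K`, evaluated in `K̄`), and `ψ ≠ 0` over `K̄`.
[cite: SilvermanAEC2009, Ex. III.3.7 (d)] -/
theorem aeval_xT_twoTorsionPolynomial (i : Fin 3) :
    Polynomial.aeval (xT W h2 i) W.twoTorsionPolynomial.toPoly = 0 ∧
      (Cubic.map (algebraMap K (AlgebraicClosure K)) W.twoTorsionPolynomial).toPoly ≠ 0 := by
  have hmem : xT W h2 i ∈ (Cubic.map (algebraMap K (AlgebraicClosure K)) W.twoTorsionPolynomial).roots := by
    rw [roots_twoTorsionPolynomial W h2]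
    fin_cases i <;> simp
  obtain ⟨hne, hroot⟩ := Polynomial.mem_roots'.mp hmem
  refine ⟨?_, hne⟩
  rw [Cubic.map_toPoly] at hroot
  rwa [Polynomial.aeval_def, ← Polynomial.eval_map]

/-- A root in `K̄` of the `2`-division cubic of `A` is the abscissa of one of `T₀^A, T₁^A, T₂^A` (a cubic with three
known distinct roots has no other). [cite: SilvermanAEC2009, Ex. III.3.7 (d) and Cor. III.6.4(b)] -/
theorem exists_eq_xT_of_aeval_twoTorsionPolynomial_eq_zero {y : AlgebraicClosure K}
    (hy : Polynomial.aeval y A.twoTorsionPolynomial.toPoly = 0) : ∃ j : Fin 3, y = xT A h2 j := by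
  have hne := (aeval_xT_twoTorsionPolynomial h2 A 0).2
  have hmem : y ∈ (Cubic.map (algebraMap K (AlgebraicClosure K)) A.twoTorsionPolynomial).roots := by
    refine Polynomial.mem_roots'.mpr ⟨hne, ?_⟩
    rw [Cubic.map_toPoly, Polynomial.IsRoot, Polynomial.eval_map, ← Polynomial.aeval_def]
    exact hy
  rw [roots_twoTorsionPolynomial A h2] at hmem
  simp only [Multiset.insert_eq_cons, Multiset.mem_cons, Multiset.mem_singleton] at hmem
  rcases hmem with h | h | h
  · exact ⟨0, h⟩
  · exact ⟨1, h⟩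
  · exact ⟨2, h⟩

/-- In the frame `E[2] ≅ (ℤ/2)²`, the letter `T_i` is the vector `v_i` (definition of `T`). [folklore] -/
theorem frame_T' (i : Fin 3) : frame W h2 (T W h2 i) = vec i := by
  rw [DokchitserDokchitser2012.T, AddEquiv.apply_symm_apply]

omit [W.IsElliptic] in
/-- `σ • 0 = 0` on `E[2]` (the Galois action is by additive automorphisms). [folklore] -/
theorem smul_zero_geomTorsion_two (σ : Field.absoluteGaloisGroup K) : σ • (0 : geomTorsion W 2) = 0 := by
  rw [← rho_apply, map_zero]

include h2 in
/-- **KERNEL CERTIFICATE FOR `E[2] ≅ A[2]` (Galois modules) — the Tschirnhaus road.** Let `W, A` be elliptic curves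
over a field `K` with `2 ≠ 0` and `q, r ∈ K[x]` such that for every root `ξ ∈ K̄` of `ψ_W = 4x³ + b₂x² + 2b₄x + b₆`:
`ψ_A(q(ξ)) = 0` and `r(q(ξ)) = ξ`. Then there is an additive isomorphism `e : W[2] ≃ A[2]` with `e(σP) = σ e(P)` for
every `σ ∈ Γ_K` — `T_i^W ↦ T^A_{π i}` where `x(T^A_{π i}) = q(x(T_i^W))`; `π` is a permutation (left inverse `r`)
intertwining the two Galois permutation actions (`q, r` have coefficients in `K`), and every permutation of the
nonzero vectors of `(ℤ/2)²` is additive. [cite: SilvermanAEC2009, III.§1, III.2.3, Cor. III.6.4(b), III.§7 and VIII.§1]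
[cite: DokchitserDokchitserMathZ2012, proof of the Theorem (first paragraph)] -/
theorem exists_equivariant_addEquiv_geomTorsion_two_of_tschirnhaus (q r : K[X])
    (hroot : ∀ ξ : AlgebraicClosure K, Polynomial.aeval ξ W.twoTorsionPolynomial.toPoly = 0 →
      Polynomial.aeval (Polynomial.aeval ξ q) A.twoTorsionPolynomial.toPoly = 0)
    (hinv : ∀ ξ : AlgebraicClosure K, Polynomial.aeval ξ W.twoTorsionPolynomial.toPoly = 0 →
      Polynomial.aeval (Polynomial.aeval ξ q) r = ξ) :
    ∃ e : geomTorsion W (2 : ℤ) ≃+ geomTorsion A (2 : ℤ),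
      ∀ (σ : Field.absoluteGaloisGroup K) (P : geomTorsion W (2 : ℤ)), e (σ • P) = σ • e P := by
  -- the roots `ξ_i = x(T_i^W)` and their images `y_i = q(ξ_i)`, each some `x(T^A_j)`
  have hξ : ∀ i, Polynomial.aeval (xT W h2 i) W.twoTorsionPolynomial.toPoly = 0 :=
    fun i ↦ (aeval_xT_twoTorsionPolynomial h2 W i).1
  have hy : ∀ i, ∃ j : Fin 3, Polynomial.aeval (xT W h2 i) q = xT A h2 j :=
    fun i ↦ exists_eq_xT_of_aeval_twoTorsionPolynomial_eq_zero h2 A (hroot _ (hξ i))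
  choose j hj using hy
  -- `j` is injective (left inverse `r`), hence a permutation
  have hjinj : Function.Injective j := by
    intro i i' hii'
    apply xT_injective W h2
    rw [← hinv _ (hξ i), ← hinv _ (hξ i'), hj, hj, hii']
  let π : Equiv.Perm (Fin 3) := Equiv.ofBijective j hjinj.bijective_of_finite
  have hπ : ∀ i, π i = j i := fun _ ↦ rfl
  -- `j` intertwines the two Galois permutation actions
  have hgal : ∀ (σ : Field.absoluteGaloisGroup K) (i : Fin 3), permGal A h2 σ (j i) = j (permGal W h2 σ i) := by
    intro σ i
    apply xT_injective A h2
    rw [← smul_xT, ← hj, ← hj, ← smul_xT]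
    exact (Polynomial.aeval_algHom_apply
      ((show AlgebraicClosure K ≃ₐ[K] AlgebraicClosure K from σ) :
        AlgebraicClosure K →ₐ[K] AlgebraicClosure K) (xT W h2 i) q).symm
  -- the additive map on `(ℤ/2)²` and the isomorphism through the frames
  obtain ⟨L, hL⟩ := exists_addEquiv_apply_vec_eq π
  refine ⟨(frame W h2).trans (L.trans (frame A h2).symm), fun σ P ↦ ?_⟩
  have he : ∀ i, ((frame W h2).trans (L.trans (frame A h2).symm)) (T W h2 i) = T A h2 (j i) := by
    intro i
    rw [AddEquiv.trans_apply, AddEquiv.trans_apply, frame_T', hL, hπ, DokchitserDokchitser2012.T]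
  rcases eq_zero_or_eq_T W h2 P with rfl | ⟨i, rfl⟩
  · rw [smul_zero_geomTorsion_two, map_zero, smul_zero_geomTorsion_two]
  · rw [← T_permGal, he, he, ← T_permGal, hgal]

omit [W.IsElliptic] [A.IsElliptic] in
/-- **Symmetric bookkeeping**: the inverse of an equivariant `e` is equivariant, so the certificate may be run in
either direction (from `A` to `W`). [folklore] -/
theorem equivariant_symm {e : geomTorsion W (2 : ℤ) ≃+ geomTorsion A (2 : ℤ)}
    (he : ∀ (σ : Field.absoluteGaloisGroup K) (P : geomTorsion W (2 : ℤ)), e (σ • P) = σ • e P) :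
    ∀ (σ : Field.absoluteGaloisGroup K) (Q : geomTorsion A (2 : ℤ)), e.symm (σ • Q) = σ • e.symm Q := by
  intro σ Q
  apply e.injective
  rw [AddEquiv.apply_symm_apply, he, AddEquiv.apply_symm_apply]

end Certificate

end ThetaPartnerXRoute

end Summit.BirchSwinnertonDyer.BirchSwinnertonDyer.Theorems

end
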